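import Literature.Geometry.Lorentzian.CurvatureNaturality
import Literature.Geometry.Lorentzian.MetricValCongr
import Literature.Geometry.Lorentzian.WeylConformal
import Literature.Geometry.Lorentzian.IsometryProofs
import Literature.Geometry.Lorentzian.LeviCivitaProofs
import HarnessLib

/-!
# Budget transfer, pointwise part: scalar curvature and `|W|²` along an isometric regluing

Support file (everything proved; no definitions, no named facts) for the support item
`BudgetTransfer` of route WeylBudget (`Summits/SmoothPoincare4/SmoothPoincare4/Theses/WeylBudget.lean`,
item stmt-SmoothPoincare4-3208): a piece `C` (any model with corners on the model vector space `E`,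
e.g. a compact `4`-manifold with boundary) is mapped into two manifolds `P`, `Q` by smooth maps
`j : C → P`, `k : C → Q` with injective differential, and smooth metrics `g` on `P`, `γ` on `Q`
induce THE SAME piece metric, `j^* g = k^* γ` (`pullbackBilin`). Then at every point `c` of the
piece — boundary points included — the scalar curvatures and the pointwise Weyl norms agree:
`S_γ(k c) = S_g(j c)` and `|W_γ|²(k c) = |W_g|²(j c)`.

Proof: both `j^* g` and `k^* γ` are honest pullback metrics on `C` (`PseudoRiemannianMetric.comap`,
with their Levi-Civita connections by `hasLeviCivita`) with the same values, so O'Neill's naturality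
of curvature under local isometries (`scalarCurvature_comap`, `weylNormSq_comap`, Ch. 3, Prop. 3.59)
on both sides and `scalarCurvature_congr_of_val_eq` / `weylNormSq_congr_of_val_eq` conclude.

## References

* B. O'Neill, *Semi-Riemannian geometry* (1983), Ch. 3, Prop. 3.59, pp. 90–91. [ONeill1983]
* A. L. Besse, *Einstein Manifolds* (1987), (1.116)–1.117. [Besse1987]
-/

noncomputable section

-- the registered namespace `Summit.SmoothPoincare4.SmoothPoincare4.Theorems` repeats a component
set_option linter.dupNamespace false

open scoped Manifold ContDiff Topology
open Set Function
open Literature.Geometry.Lorentzian Literature.Geometry.Lorentzian.PseudoRiemannianMetric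

namespace Summit.SmoothPoincare4.SmoothPoincare4.Theorems

namespace BudgetTransfer

variable {E : Type*} [NormedAddCommGroup E] [NormedSpace ℝ E] [FiniteDimensional ℝ E]
  [CompleteSpace E]
  {HP : Type*} [TopologicalSpace HP] {IP : ModelWithCorners ℝ E HP}
  {P : Type*} [TopologicalSpace P] [ChartedSpace HP P] [IsManifold IP ∞ P]
  {HQ : Type*} [TopologicalSpace HQ] {IQ : ModelWithCorners ℝ E HQ}
  {Q : Type*} [TopologicalSpace Q] [ChartedSpace HQ Q] [IsManifold IQ ∞ Q]
  {HC : Type*} [TopologicalSpace HC] {IC : ModelWithCorners ℝ E HC}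
  {C : Type*} [TopologicalSpace C] [ChartedSpace HC C] [IsManifold IC ∞ C]
  (g : PseudoRiemannianMetric IP ∞ E (TangentSpace IP : P → Type _)) [g.HasLeviCivita]
  (γ : PseudoRiemannianMetric IQ ∞ E (TangentSpace IQ : Q → Type _)) [γ.HasLeviCivita]
  {j : C → P} {k : C → Q}

omit [FiniteDimensional ℝ E] [CompleteSpace E] [IsManifold IP ∞ P] [IsManifold IC ∞ C] in
/-- `∞ + 1 = ∞` in `ℕ∞ω`: a `C^∞` map is `C^{∞+1}` (the regularity `comap` asks of the map).
[folklore] -/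
theorem contMDiff_infty_add_one {f : C → P} (hf : ContMDiff IC IP ∞ f) :
    ContMDiff IC IP (∞ + 1) f := by
  have h : ((∞ : ℕ∞ω) + 1) = ∞ := rfl
  rw [h]
  exact hf

/-- **Scalar curvature transfers pointwise along an isometric regluing.** If `j : C → P`,
`k : C → Q` are smooth with injective differential and `j^* g = k^* γ` on the piece `C`, then
`S_γ(k c) = S_g(j c)` for every `c : C` (boundary points of `C` included): the two pullback
metrics on `C` coincide, and local isometries preserve scalar curvature (O'Neill 1983, Ch. 3,
Prop. 3.59). [cite: ONeill1983, Ch. 3, Prop. 3.59] -/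
theorem scalarCurvature_eq_of_pullbackBilin_eq
    (hj : ContMDiff IC IP ∞ j) (hj' : ∀ c, Injective (mfderiv IC IP j c))
    (hk : ContMDiff IC IQ ∞ k) (hk' : ∀ c, Injective (mfderiv IC IQ k c))
    (hiso : ∀ c, pullbackBilin (I := IP) (I' := IC) j g.val c =
      pullbackBilin (I := IQ) (I' := IC) k γ.val c)
    (c : C) : γ.scalarCurvature (k c) = g.scalarCurvature (j c) := by
  set gC := g.comap (contMDiff_pullbackBilin_holds (I := IP) (M := P) (I' := IC) (N := C)) j
    (contMDiff_infty_add_one hj) hj' rfl with hgC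
  set γC := γ.comap (contMDiff_pullbackBilin_holds (I := IQ) (M := Q) (I' := IC) (N := C)) k
    (contMDiff_infty_add_one hk) hk' rfl with hγC
  haveI := gC.hasLeviCivita
  haveI := γC.hasLeviCivita
  have hvals : ∀ c, gC.val c = γC.val c := fun c ↦ by
    rw [hgC, hγC, val_comap, val_comap, hiso c]
  rw [← γ.scalarCurvature_comap _ (contMDiff_infty_add_one hk) hk' rfl c,
    ← g.scalarCurvature_comap _ (contMDiff_infty_add_one hj) hj' rfl c]
  exact (scalarCurvature_congr_of_val_eq hvals c).symm

/-- **The pointwise Weyl norm transfers along an isometric regluing.** With `j`, `k`, `g`, `γ`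
as in `scalarCurvature_eq_of_pullbackBilin_eq` and both metrics Riemannian,
`|W_γ|²(k c) = |W_g|²(j c)` for every `c : C` (naturality of `Rm`, `Ric`, `S`, hence of the Weyl
tensor and of its `(0,4)`-norm, under local isometries; O'Neill 1983, Ch. 3, Prop. 3.59;
Besse 1987, (1.116)). [cite: ONeill1983, Ch. 3, Prop. 3.59] [cite: Besse1987, (1.116)] -/
theorem weylNormSq_eq_of_pullbackBilin_eq (hg : g.IsRiemannian) (hγ : γ.IsRiemannian)
    (hj : ContMDiff IC IP ∞ j) (hj' : ∀ c, Injective (mfderiv IC IP j c))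
    (hk : ContMDiff IC IQ ∞ k) (hk' : ∀ c, Injective (mfderiv IC IQ k c))
    (hiso : ∀ c, pullbackBilin (I := IP) (I' := IC) j g.val c =
      pullbackBilin (I := IQ) (I' := IC) k γ.val c)
    (c : C) : γ.weylNormSq (k c) = g.weylNormSq (j c) := by
  set gC := g.comap (contMDiff_pullbackBilin_holds (I := IP) (M := P) (I' := IC) (N := C)) j
    (contMDiff_infty_add_one hj) hj' rfl with hgC
  set γC := γ.comap (contMDiff_pullbackBilin_holds (I := IQ) (M := Q) (I' := IC) (N := C)) k
    (contMDiff_infty_add_one hk) hk' rfl with hγC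
  haveI := gC.hasLeviCivita
  haveI := γC.hasLeviCivita
  have hvals : ∀ c, gC.val c = γC.val c := fun c ↦ by
    rw [hgC, hγC, val_comap, val_comap, hiso c]
  rw [← γ.weylNormSq_comap _ (contMDiff_infty_add_one hk) hk' rfl hγ c,
    ← g.weylNormSq_comap _ (contMDiff_infty_add_one hj) hj' rfl hg c]
  exact (weylNormSq_congr_of_val_eq hvals c).symm

end BudgetTransfer

end Summit.SmoothPoincare4.SmoothPoincare4.Theorems

end
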